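import Literature.Combinatorics.Optimization.KnapsackPseudoDensity
import Literature.Barriers.PneNP.TSPExtensionComplexityProofs
import HarnessLib

/-!
# Psd rank of the TSP polytope: Lee–Raghavendra–Steurer 2015 Cor. 1.2 (TSP) DERIVED from Thm 3.8

Companion of `CutTspStabPsdRank.lean` (same directory), which TYPES LRS Corollary 1.2 as three named
facts (`LeeRaghavendraSteurer2015_cor12_cut/_tsp/_stab`: the full slack matrix of `CUT_n` / `TSP_n` /
some `STAB_n(G)` has no psd factorisation of size `m < 2^{α n^{2/13}}` resp. `2^{α n^{1/13}}`) and
proves the cut clause from Thm 1.1, and of `KnapsackPseudoDensity.lean`, which derives Thm 1.1 = 5.4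
from the engine Thm 3.8 (`LeeRaghavendraSteurer2015_thm11_of_thm38`, through `thm54_large`: for large
`n` and `r < 2^{n^{2/13}/8}` the knapsack pattern matrix `M_n^f`, `f` = eq. (5.1), has no psd
factorisation of size `r`).  This file PROVES the TSP clause modulo the same single engine fact:

* `HasPsdFactorization.patternMatrix_knapsackGap_of_tspSlack` — for `N ≥ 15n² + 2n` and odd `m`, a
  psd factorisation of size `r` of the full slack matrix of `TSP_N` restricts to one of the knapsack
  pattern matrix `M_n^f` (`f = knapsackGap m`, eq. (5.1));
* `LeeRaghavendraSteurer2015_cor12_tsp_of_thm38 : LeeRaghavendraSteurer2015_thm38 →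
  LeeRaghavendraSteurer2015_cor12_tsp` (with `α = 1/16`, `n := ⌊√N⌋/5`).

**The printed route and ours.**  LRS (p. 4, p. 22): "By results of [DeSimone90] and [FMPTW12] (see
Prop. 5.2), Thm 1.1 directly implies … `rk_psd(TSP_n) ≥ 2^{Ω(n^{1/13})}`", Prop. 5.2: "some face of
`TSP_{a_n}`, `a_n ≤ O(n²)`, linearly projects to `CORR_n`" — FMPTW's Lemma 11 (PDF p. 10–11), whose
graph is the textbook 3SAT → directed-Hamiltonian-path gadget.  The tree discharged FMPTW's Thm 12
(`Literature.Barriers.PneNP.TSPExtensionComplexity_holds`) with a DIFFERENT, fully formalised graph on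
the vertex type `GV n pad` (`|GV n pad| = 15n² + 2n + pad`; files `TSPExtensionComplexityGadget*.lean`):
`2^n` designated tours `T_b` (`b ⊆ [n]`) with bit readouts `B_i(T_b) = [i ∈ b]` (chain edge `ge i`
unused) and pair readouts `Y_{ij}(T_b) = [i ∈ b][j ∈ b]` (plain triangle edge `rpe (i,j)` unused), and
for EVERY tour `T` of the complete graph inside the gadget graph the one-sided law
`B_i(T) ∧ B_j(T) → Y_{ij}(T)` (`rpe_not_mem_of_bits`).  That one-sided law does not give an exact
linear projection onto `CORR_n` (so we do not pass through Thm 1.1 as a black box), but it is exactly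
what Prop. 5.1's mechanism needs for the quadratic `f` of eq. (5.1), whose off-diagonal coefficients are
NEGATIVE: for an `m`-subset `S ⊆ [n]`, `m` odd, the linear functional
`Σ_{p ∈ S.offDiag} x_{rpe p} − (m−1) Σ_{i ∈ S} x_{ge i} − n²·#{foreign edges}` is at most `(m²−1)/4`
on every tour (`TspKnapsack.tour_ineq`: inside the gadget graph its value is `≤ k(m−k) ≤ (m²−1)/4` with
`k` the number of set bits in `S`, since `(m−2k)² ≥ 1` for odd `m`), and equals `w(m−w)`,
`w = |S ∩ b|`, at `T_b` (`TspKnapsack.sum_coeff_tourEdges`); the slack `((m−2w)² − 1)/4 = m² f(b_S)`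
is the knapsack pattern.  Hence `M_n^f` (scaled by `1/m²`) is a generalised submatrix of the full slack
matrix of `TSP_N`, and `thm54_large` applies with `n ≍ √N`: `N ≤ 100 n² ≤ 2^{13} n²` gives
`N^{1/13}/16 ≤ n^{2/13}/8`.

Sources: J. R. Lee, P. Raghavendra, D. Steurer, STOC 2015 [LeeRaghavendraSteurer2015], held text
`paper:arxiv-1411.6317`: Cor. 1.2 (p. 4), Prop. 5.1/5.2 (p. 22), eq. (5.1) and Thm 5.4 (p. 23);
S. Fiorini, S. Massar, S. Pokutta, H. R. Tiwary, R. de Wolf, J. ACM 62 (2015) [FioriniEtAl2015], held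
text `paper:arxiv-1111.0837`: Lemma 9 (faces/extensions, PDF p. 10), Lemma 11 (PDF p. 10–11).
Nothing is vendored as a fact; no new definition beyond the two bookkeeping functionals
`TspKnapsack.coeff` / `TspKnapsack.rhs`.
-/

noncomputable section

open Finset Matrix

namespace Literature.Combinatorics.Optimization

open Literature.Barriers.PneNP

namespace TspKnapsack

variable {n pad : ℕ}

/-- The coefficient vector, on the edges of the complete graph on `GV n pad`, of the knapsack
inequality of an `m`-subset `S ⊆ [n]`: `+1` per ordered pair `p ∈ S.offDiag` whose plain triangle
edge `rpe p` it is, `−(m−1)` per `i ∈ S` whose chain edge `ge i` it is, `−n²` if it is not an edge of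
the gadget graph (Prop. 5.1's planted quadratic `f` of eq. (5.1), read through the gadget's bit / pair
edges as in FMPTW Lemma 6/11). [cite: LeeRaghavendraSteurer2015, Prop. 5.1 and eq. (5.1) (p. 22–23)] -/
def coeff (S : Finset (Fin n)) (e : Sym2 (GV n pad)) : ℝ :=
  ((S.offDiag.filter fun p => rpe p = e).card : ℝ)
    - ((S.card : ℝ) - 1) * ((S.filter fun i => ge i = e).card : ℝ)
    - (n : ℝ) ^ 2 * (if e ∈ (gadgetGraph n pad).edgeSet then 0 else 1)

/-- The right-hand side `(m² − 1)/4 = k₀(k₀+1)` (`m = |S| = 2k₀+1`) of the knapsack inequality of `S`.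
[cite: LeeRaghavendraSteurer2015, eq. (5.1) (p. 23)] -/
def rhs (S : Finset (Fin n)) : ℝ := (((S.card : ℝ)) ^ 2 - 1) / 4

/-- Summing the coefficients over an edge set gives the counting expression
`#{p ∈ S.offDiag : rpe p ∈ T} − (m−1)·#{i ∈ S : ge i ∈ T} − n²·#{e ∈ T foreign}` (bookkeeping,
private). [folklore] -/
private theorem sum_coeff (S : Finset (Fin n)) (T : Finset (Sym2 (GV n pad))) :
    ∑ e ∈ T, coeff S e =
      ((S.offDiag.filter fun p => rpe p ∈ T).card : ℝ)
        - ((S.card : ℝ) - 1) * ((S.filter fun i => ge i ∈ T).card : ℝ)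
        - (n : ℝ) ^ 2 * ((T.filter fun e => e ∉ (gadgetGraph n pad).edgeSet).card : ℝ) := by
  classical
  simp only [coeff, Finset.sum_sub_distrib, ← Finset.mul_sum]
  rw [sum_card_filter_eq, sum_card_filter_eq]
  congr 1
  rw [Finset.card_filter]
  push_cast
  simp only [ite_not]

/-- **The knapsack inequality for tours inside the gadget graph.** With `k` the number of set bits
of `T` in `S` (`ge i ∉ T`), pairs of set bits avoid their plain edge, so the counting expression is at
most `(|S.offDiag| − k(k−1)) − (m−1)(m−k) = k(m−k) ≤ (m²−1)/4` for odd `m = |S|` (as `(m−2k)² ≥ 1`).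
[cite: LeeRaghavendraSteurer2015, Prop. 5.1 (p. 22: "q(x) ≥ 0 for all x ∈ {0,1}ⁿ")] -/
theorem tour_ineq_supported {T : Finset (Sym2 (GV n pad))} (hT : IsTourOn T)
    (hTG : ∀ e ∈ T, e ∈ (gadgetGraph n pad).edgeSet) {S : Finset (Fin n)} (hS : Odd S.card) :
    ((S.offDiag.filter fun p => rpe p ∈ T).card : ℝ)
        - ((S.card : ℝ) - 1) * ((S.filter fun i => ge i ∈ T).card : ℝ) ≤ rhs S := by
  classical
  set B := S.filter fun i => ge i ∉ T with hB
  -- pairs of set bits avoid the plain edge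
  have hsub : (S.offDiag.filter fun p => rpe p ∈ T) ⊆ S.offDiag \ B.offDiag := by
    intro p hp
    rw [mem_filter] at hp
    rw [mem_sdiff]
    refine ⟨hp.1, fun hpB => ?_⟩
    rw [mem_offDiag] at hpB
    obtain ⟨h1, h2, h12⟩ := hpB
    rw [hB, mem_filter] at h1 h2
    exact rpe_not_mem_of_bits hT hTG h12 h1.2 h2.2 hp.2
  have hBoff : B.offDiag ⊆ S.offDiag := offDiag_mono (filter_subset _ S)
  have h1 : (S.offDiag.filter fun p => rpe p ∈ T).card + B.offDiag.card ≤ S.offDiag.card := by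
    have := card_le_card hsub
    rw [card_sdiff_of_subset hBoff] at this
    have := card_le_card hBoff
    omega
  -- bits split `S`
  have h2 : (S.filter fun i => ge i ∈ T).card + B.card = S.card := by
    rw [hB]
    convert card_filter_add_card_filter_not (s := S) (fun i => ge i ∈ T) using 3
  have h3 : B.offDiag.card = B.card * B.card - B.card := offDiag_card B
  have h4 : S.offDiag.card = S.card * S.card - S.card := offDiag_card S
  have hkB : B.card ≤ B.card * B.card := Nat.le_mul_self _
  have hkS : S.card ≤ S.card * S.card := Nat.le_mul_self _
  -- real-number forms
  have e1 : ((S.offDiag.filter fun p => rpe p ∈ T).card : ℝ) +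
      ((B.card : ℝ) * B.card - B.card) ≤ (S.card : ℝ) * S.card - S.card := by
    have h1' : (((S.offDiag.filter fun p => rpe p ∈ T).card +
        (B.card * B.card - B.card) : ℕ) : ℝ) ≤ ((S.card * S.card - S.card : ℕ) : ℝ) := by
      rw [← h3, ← h4]; exact_mod_cast h1
    push_cast [Nat.cast_sub hkB, Nat.cast_sub hkS] at h1'
    linarith
  have e2 : ((S.filter fun i => ge i ∈ T).card : ℝ) = S.card - B.card := by
    have : (((S.filter fun i => ge i ∈ T).card + B.card : ℕ) : ℝ) = S.card := by exact_mod_cast h2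
    push_cast at this
    linarith
  -- oddness: `(m − 2k)² ≥ 1`
  have hodd : (1 : ℝ) ≤ ((S.card : ℝ) - 2 * B.card) ^ 2 := by
    obtain ⟨t, ht⟩ := hS
    have hne : ((S.card : ℤ) - 2 * B.card) ≠ 0 := by omega
    have habs : (1 : ℤ) ≤ |(S.card : ℤ) - 2 * B.card| := Int.one_le_abs hne
    have hsq : (1 : ℤ) ≤ ((S.card : ℤ) - 2 * B.card) ^ 2 := by
      calc (1 : ℤ) = 1 * 1 := by ring
        _ ≤ |(S.card : ℤ) - 2 * B.card| * |(S.card : ℤ) - 2 * B.card| :=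
            mul_le_mul habs habs zero_le_one (abs_nonneg _)
        _ = ((S.card : ℤ) - 2 * B.card) ^ 2 := by rw [← sq, sq_abs]
    have : ((1 : ℤ) : ℝ) ≤ ((((S.card : ℤ) - 2 * B.card) ^ 2 : ℤ) : ℝ) := by exact_mod_cast hsq
    push_cast at this
    exact this
  rw [e2, rhs]
  nlinarith [e1, hodd]

/-- **The knapsack inequality for ALL tours of the complete graph on `GV n pad`**, with the penalty
`n²` per edge outside the gadget graph (for such tours the counting expression is at most
`|S.offDiag| ≤ n² − n`). [cite: LeeRaghavendraSteurer2015, Prop. 5.1 (p. 22)] -/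
theorem tour_ineq {T : Finset (Sym2 (GV n pad))} (hT : IsTourOn T) {S : Finset (Fin n)}
    (hS : Odd S.card) : ∑ e ∈ T, coeff S e ≤ rhs S := by
  classical
  rw [sum_coeff]
  by_cases hTG : ∀ e ∈ T, e ∈ (gadgetGraph n pad).edgeSet
  · have h0 : (T.filter fun e => e ∉ (gadgetGraph n pad).edgeSet).card = 0 := by
      rw [card_eq_zero, filter_eq_empty_iff]
      exact fun e he h => h (hTG e he)
    rw [h0]
    simpa using tour_ineq_supported hT hTG hS
  · push Not at hTG
    obtain ⟨e₀, he₀, he₀G⟩ := hTG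
    have hpen : 1 ≤ (T.filter fun e => e ∉ (gadgetGraph n pad).edgeSet).card :=
      card_pos.2 ⟨e₀, mem_filter.2 ⟨he₀, he₀G⟩⟩
    have hf : (S.offDiag.filter fun p => rpe p ∈ T).card ≤ S.offDiag.card :=
      card_le_card (filter_subset _ _)
    have h4 : S.offDiag.card = S.card * S.card - S.card := offDiag_card S
    have hkS : S.card ≤ S.card * S.card := Nat.le_mul_self _
    have hSn : S.card ≤ n := by simpa using card_le_univ S
    have hS1 : 1 ≤ S.card := by obtain ⟨t, ht⟩ := hS; omega
    have hfR : ((S.offDiag.filter fun p => rpe p ∈ T).card : ℝ) ≤ (S.card : ℝ) * S.card - S.card := by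
      have : (((S.offDiag.filter fun p => rpe p ∈ T).card : ℕ) : ℝ) ≤
          ((S.card * S.card - S.card : ℕ) : ℝ) := by rw [← h4]; exact_mod_cast hf
      push_cast [Nat.cast_sub hkS] at this
      exact this
    have hSnR : (S.card : ℝ) ≤ n := by exact_mod_cast hSn
    have hS1R : (1 : ℝ) ≤ S.card := by exact_mod_cast hS1
    have hpenR : (1 : ℝ) ≤ ((T.filter fun e => e ∉ (gadgetGraph n pad).edgeSet).card : ℝ) := by
      exact_mod_cast hpen
    have hge0 : (0 : ℝ) ≤ ((S.filter fun i => ge i ∈ T).card : ℝ) := by positivity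
    rw [rhs]
    nlinarith [mul_nonneg (sub_nonneg.2 hS1R) hge0, mul_le_mul hSnR hSnR (by positivity) (by positivity)]

/-- **The value at the designated tour `T_b`**: the counting expression equals `w(m − w)` with
`w = |S ∩ b|`, so the slack is `(m²−1)/4 − w(m−w) = ((m−2w)² − 1)/4 = m² f(b_S)` — the knapsack
pattern of eq. (5.1). [cite: LeeRaghavendraSteurer2015, eq. (5.1) and Thm 5.4 proof (p. 23)] -/
theorem sum_coeff_tourEdges (hn : 0 < n) (S b : Finset (Fin n)) :
    ∑ e ∈ tourEdges pad b, coeff S e =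
      ((S ∩ b).card : ℝ) * ((S.card : ℝ) - (S ∩ b).card) := by
  rw [sum_coeff]
  have h0 : ((tourEdges pad b).filter fun e => e ∉ (gadgetGraph n pad).edgeSet).card = 0 := by
    rw [card_eq_zero, filter_eq_empty_iff]
    exact fun e he h => h (tourEdges_subset b hn e he)
  rw [h0, card_filter_ge b hn, card_filter_rpe b hn]
  have hsub : (S ∩ b).offDiag ⊆ S.offDiag := offDiag_mono inter_subset_left
  have h1 := card_le_card hsub
  have h2 : (S \ b).card + (S ∩ b).card = S.card := card_sdiff_add_card_inter S b
  have h3 : (S ∩ b).offDiag.card = (S ∩ b).card * (S ∩ b).card - (S ∩ b).card := offDiag_card _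
  have h4 : S.offDiag.card = S.card * S.card - S.card := offDiag_card S
  have hk : (S ∩ b).card ≤ (S ∩ b).card * (S ∩ b).card := Nat.le_mul_self _
  have hkS : S.card ≤ S.card * S.card := Nat.le_mul_self _
  rw [Nat.cast_sub h1, h3, h4, Nat.cast_sub hk, Nat.cast_sub hkS]
  push_cast
  have h2' : ((S \ b).card : ℝ) = S.card - (S ∩ b).card := by
    have : (((S \ b).card + (S ∩ b).card : ℕ) : ℝ) = S.card := by exact_mod_cast h2
    push_cast at this
    linarith
  rw [h2']
  ring

end TspKnapsack

/-! ### The pattern-matrix entry as a function of `|S ∩ b|` -/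

/-- The Hamming weight of `x_S` (coordinates of `x` listed along `S` in increasing order) is
`#{i ∈ S : x_i = 1}`. [cite: LeeRaghavendraSteurer2015, §1 (eq. (restriction): x_S)] -/
theorem sum_cubePoint_orderEmbOfFin {n m : ℕ} (S : Finset (Fin n)) (hS : S.card = m)
    (x : Fin n → Bool) :
    ∑ j, cubePoint (fun j => x (S.orderEmbOfFin hS j)) j = ((S.filter fun i => x i = true).card : ℝ) := by
  classical
  calc ∑ j, cubePoint (fun j => x (S.orderEmbOfFin hS j)) j
      = ∑ i : S, (if x i = true then (1 : ℝ) else 0) := by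
        refine Fintype.sum_equiv (S.orderIsoOfFin hS).toEquiv _ _ fun j => ?_
        simp only [cubePoint]
        rfl
    _ = ∑ i ∈ S, (if x i = true then (1 : ℝ) else 0) :=
        Finset.sum_coe_sort S (fun i => if x i = true then (1 : ℝ) else 0)
    _ = ((S.filter fun i => x i = true).card : ℝ) := by rw [Finset.sum_boole]

/-- The knapsack pattern-matrix entry: `f(x_S) = ((m − 2w)² − 1)/(4m²)` with `w = #{i ∈ S : x_i = 1}`.
[cite: LeeRaghavendraSteurer2015, eq. (5.1) (p. 23)] -/
theorem patternMatrix_knapsackGap_eq {n m : ℕ} (S : {S : Finset (Fin n) // S.card = m})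
    (x : Fin n → Bool) :
    patternMatrix n (knapsackGap m) S x =
      (1 / (m : ℝ) ^ 2) * ((((S.1.filter fun i => x i = true).card : ℝ) - (m : ℝ) / 2) ^ 2 - 1 / 4) := by
  rw [patternMatrix_apply, knapsackGap, sum_cubePoint_orderEmbOfFin S.1 S.2 x]

/-! ### The transfer: TSP slack ⟶ knapsack pattern matrix -/

/-- **LRS Prop. 5.2 (TSP), factorisation form for the knapsack pattern (PROVED).**  For
`N ≥ 15n² + 2n`, `n ≥ 1` and odd `m`, a positive-semidefinite factorisation of size `r` of the full
slack matrix of `TSP_N` (rows: all valid linear inequalities on the tours of `K_N`; columns: the tours)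
restricts to one of the knapsack pattern matrix `M_n^f`, `f(x) = m^{-2}((Σ x_i − m/2)² − 1/4)`: row
`S` ↦ the knapsack inequality of `S` transported to `K_N` along `GV n pad ≃ Fin N` and scaled by
`1/m²`, column `x` ↦ the designated tour `T_{{i : x_i = 1}}`. (The printed Prop. 5.2 goes through a
face of `TSP_{O(n²)}` projecting onto `CORR_n` [FMPTW12, Lemma 11]; here the tree's XOR-gadget graph of
`TSPExtensionComplexityGadget*.lean` is used instead, whose one-sided pair readout suffices for this
`f`.) [cite: LeeRaghavendraSteurer2015, Prop. 5.2 (p. 22) and Thm 5.4 proof (p. 23)] -/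
theorem HasPsdFactorization.patternMatrix_knapsackGap_of_tspSlack {n N m r : ℕ} (hn : 0 < n)
    (hN : 15 * n ^ 2 + 2 * n ≤ N) (hm : Odd m)
    (h : HasPsdFactorization (fullSlackMatrix (tourVector (n := N))) r) :
    HasPsdFactorization (patternMatrix n (knapsackGap m)) r := by
  classical
  -- the gadget vertex type with the right padding has exactly `N` elements
  obtain ⟨pad, hpad⟩ : ∃ pad, N = 15 * n ^ 2 + 2 * n + pad := ⟨N - (15 * n ^ 2 + 2 * n), by omega⟩
  have hcard : Fintype.card (GV n pad) = N := by rw [GV.card, hpad]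
  let eqv : GV n pad ≃ Fin N := Fintype.equivFinOfCardEq hcard
  have hm1 : 1 ≤ m := by obtain ⟨t, ht⟩ := hm; omega
  have hm0 : (0 : ℝ) < m := by exact_mod_cast hm1
  set u : ℝ := 1 / (m : ℝ) ^ 2 with hu
  have hu0 : 0 ≤ u := by positivity
  -- rows: the scaled knapsack functionals, transported to the edges of `K_N`
  let c : Finset (Fin n) → (⊤ : SimpleGraph (Fin N)).edgeSet → ℝ :=
    fun S ε => u * TspKnapsack.coeff S (Sym2.map eqv.symm (ε : Sym2 (Fin N)))
  -- columns: the designated tours, transported to `K_N`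
  let Tb : Finset (Fin n) → Finset (Sym2 (Fin N)) := fun b => (tourEdges pad b).image (Sym2.map eqv)
  have hTb : ∀ b, IsTourEdgeSet (Tb b) := fun b =>
    (isTourOn_iff_isTourEdgeSet _).1 ((isTourOn_tourEdges (pad := pad) b hn).image_equiv eqv)
  -- evaluation of `c S` on the characteristic vector of a tour of `K_N`
  have heval : ∀ (S : Finset (Fin n)) (F : Finset (Sym2 (Fin N))), IsTourEdgeSet F →
      c S ⬝ᵥ charVec F = u * ∑ e ∈ F.image (Sym2.map eqv.symm), TspKnapsack.coeff S e := by
    intro S F hF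
    have hF' : IsTourOn F := (isTourOn_iff_isTourEdgeSet F).2 hF
    have h1 := dotProduct_charVec (fun x => u * TspKnapsack.coeff S (Sym2.map eqv.symm x)) F
      (fun x hx => hF'.mem_edgeSet hx)
    rw [Finset.sum_image fun x _ y _ hxy => Sym2.map.injective eqv.symm.injective hxy,
      Finset.mul_sum]
    exact h1
  -- validity on every tour of `K_N`
  have hvalid : ∀ S : Finset (Fin n), Odd S.card → ∀ τ : Tours N,
      c S ⬝ᵥ tourVector τ ≤ u * TspKnapsack.rhs S := by
    intro S hS τ
    show c S ⬝ᵥ charVec τ.1 ≤ _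
    rw [heval S τ.1 τ.2]
    exact mul_le_mul_of_nonneg_left
      (TspKnapsack.tour_ineq (((isTourOn_iff_isTourEdgeSet τ.1).2 τ.2).image_equiv eqv.symm) hS) hu0
  -- value at the designated tours
  have himg : ∀ b, (Tb b).image (Sym2.map eqv.symm) = tourEdges pad b := by
    intro b
    simp only [Tb, Finset.image_image]
    have hcomp : (Sym2.map eqv.symm ∘ Sym2.map eqv : Sym2 (GV n pad) → Sym2 (GV n pad)) = id := by
      funext e
      induction e using Sym2.ind with
      | h x y => simp
    rw [hcomp, Finset.image_id]
  have hval : ∀ S b : Finset (Fin n),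
      c S ⬝ᵥ charVec (Tb b) = u * (((S ∩ b).card : ℝ) * ((S.card : ℝ) - (S ∩ b).card)) := by
    intro S b
    rw [heval S (Tb b) (hTb b), himg, TspKnapsack.sum_coeff_tourEdges hn]
  -- assemble the restricted factorisation
  obtain ⟨A, B, hA, hB, hfac⟩ := h
  refine ⟨fun S => A ⟨(c S.1, u * TspKnapsack.rhs S.1), hvalid S.1 (by rw [S.2]; exact hm)⟩,
    fun x => B ⟨Tb (univ.filter fun i => x i = true), hTb _⟩,
    fun S => hA _, fun x => hB _, fun S x => ?_⟩
  rw [← hfac]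
  show patternMatrix n (knapsackGap m) S x =
    u * TspKnapsack.rhs S.1 - c S.1 ⬝ᵥ charVec (Tb (univ.filter fun i => x i = true))
  rw [hval, patternMatrix_knapsackGap_eq, TspKnapsack.rhs]
  have hSm : (S.1.card : ℝ) = m := by exact_mod_cast S.2
  have hfilt : S.1 ∩ (univ.filter fun i => x i = true) = S.1.filter fun i => x i = true := by
    ext i; simp
  rw [hfilt, hSm, hu]
  ring

/-! ### Corollary 1.2 (TSP) from Theorem 3.8 -/

/-- Elementary exponent comparison: if `N ≤ 100 n²` then `N^{1/13}/16 ≤ n^{2/13}/8`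
(`100 ≤ 2^{13}`). [folklore] -/
private theorem exponent_le {N n : ℕ} (hN : N ≤ 100 * n ^ 2) :
    (1 / 16 : ℝ) * (N : ℝ) ^ ((1 : ℝ) / 13) ≤ (1 / 8 : ℝ) * (n : ℝ) ^ ((2 : ℝ) / 13) := by
  have hNr : (N : ℝ) ≤ 100 * (n : ℝ) ^ 2 := by exact_mod_cast hN
  have hn0 : (0 : ℝ) ≤ n := Nat.cast_nonneg n
  have h1 : (N : ℝ) ^ ((1 : ℝ) / 13) ≤ (100 * (n : ℝ) ^ 2) ^ ((1 : ℝ) / 13) :=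
    Real.rpow_le_rpow (Nat.cast_nonneg N) hNr (by norm_num)
  have h2 : (100 * (n : ℝ) ^ 2) ^ ((1 : ℝ) / 13) =
      (100 : ℝ) ^ ((1 : ℝ) / 13) * ((n : ℝ) ^ 2) ^ ((1 : ℝ) / 13) :=
    Real.mul_rpow (by norm_num) (by positivity)
  have h3 : ((n : ℝ) ^ 2) ^ ((1 : ℝ) / 13) = (n : ℝ) ^ ((2 : ℝ) / 13) := by
    rw [← Real.rpow_natCast (n : ℝ) 2, ← Real.rpow_mul hn0]
    norm_num
  have h4 : (100 : ℝ) ^ ((1 : ℝ) / 13) ≤ 2 := by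
    have h100 : (100 : ℝ) ≤ (2 : ℝ) ^ (13 : ℕ) := by norm_num
    calc (100 : ℝ) ^ ((1 : ℝ) / 13) ≤ ((2 : ℝ) ^ (13 : ℕ)) ^ ((1 : ℝ) / 13) :=
          Real.rpow_le_rpow (by norm_num) h100 (by norm_num)
      _ = 2 := by
          rw [← Real.rpow_natCast (2 : ℝ) 13, ← Real.rpow_mul (by norm_num)]
          norm_num
  have h5 : 0 ≤ (n : ℝ) ^ ((2 : ℝ) / 13) := Real.rpow_nonneg hn0 _
  calc (1 / 16 : ℝ) * (N : ℝ) ^ ((1 : ℝ) / 13)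
      ≤ (1 / 16) * ((100 : ℝ) ^ ((1 : ℝ) / 13) * (n : ℝ) ^ ((2 : ℝ) / 13)) := by
        rw [← h3, ← h2]; exact mul_le_mul_of_nonneg_left h1 (by norm_num)
    _ ≤ (1 / 16) * (2 * (n : ℝ) ^ ((2 : ℝ) / 13)) :=
        mul_le_mul_of_nonneg_left (mul_le_mul_of_nonneg_right h4 h5) (by norm_num)
    _ = (1 / 8 : ℝ) * (n : ℝ) ^ ((2 : ℝ) / 13) := by ring

/-- **Lee–Raghavendra–Steurer 2015, Corollary 1.2 (TSP polytope: `rk_psd(TSP_n) ≥ 2^{α n^{1/13}}`)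
DERIVED from Theorem 3.8**: with `α = 1/16`, for `N ≥ max(900, 25 N₀²)` (`N₀` the threshold of
`thm54_large`) and `n := ⌊√N⌋/5` one has `15n² + 2n ≤ N ≤ 100 n²`, `n ≥ N₀`, and a psd factorisation
of the full slack matrix of `TSP_N` of size `r < 2^{N^{1/13}/16} ≤ 2^{n^{2/13}/8}` would give one of the
knapsack pattern matrix `M_n^f` (`HasPsdFactorization.patternMatrix_knapsackGap_of_tspSlack`),
contradicting Thm 3.8 + Thm 5.3 (`thm54_large`).  With `LeeRaghavendraSteurer2015_thm11_of_thm38` and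
`LeeRaghavendraSteurer2015_cor12_cut_of_thm38` the CUT and TSP clauses of Cor. 1.2 now both rest on the
single engine fact `LeeRaghavendraSteurer2015_thm38`.
[cite: LeeRaghavendraSteurer2015, Cor. 1.2 (p. 4) and Prop. 5.2 (p. 22)] -/
theorem LeeRaghavendraSteurer2015_cor12_tsp_of_thm38 (h38 : LeeRaghavendraSteurer2015_thm38) :
    LeeRaghavendraSteurer2015_cor12_tsp := by
  obtain ⟨N₀, hN₀⟩ := thm54_large h38
  refine ⟨1 / 16, by norm_num, max 900 (25 * N₀ ^ 2), fun N hN r hr hfac => ?_⟩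
  have h900 : 900 ≤ N := le_trans (le_max_left _ _) hN
  have hN0 : 25 * N₀ ^ 2 ≤ N := le_trans (le_max_right _ _) hN
  obtain ⟨n, hn⟩ : ∃ n, n = Nat.sqrt N / 5 := ⟨_, rfl⟩
  have hsq : Nat.sqrt N * Nat.sqrt N ≤ N := Nat.sqrt_le N
  have hlt : N < (Nat.sqrt N + 1) * (Nat.sqrt N + 1) := Nat.lt_succ_sqrt N
  have hn5 : 5 * n ≤ Nat.sqrt N := by rw [hn]; omega
  have hn5' : Nat.sqrt N < 5 * (n + 1) := by rw [hn]; omega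
  have h30 : 30 ≤ Nat.sqrt N := by rw [Nat.le_sqrt]; omega
  have hn0 : 0 < n := by omega
  have hle : 15 * n ^ 2 + 2 * n ≤ N := by nlinarith
  have hN100 : N ≤ 100 * n ^ 2 := by
    have h3 : N < 25 * (n + 1) ^ 2 := by nlinarith
    nlinarith
  have hnN₀ : N₀ ≤ n := by
    have : 5 * N₀ ≤ Nat.sqrt N := by
      rw [Nat.le_sqrt]; nlinarith
    omega
  have hr' : (r : ℝ) < (2 : ℝ) ^ ((1 / 8 : ℝ) * (n : ℝ) ^ ((2 : ℝ) / 13)) :=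
    hr.trans_le (Real.rpow_le_rpow_of_exponent_le one_le_two (exponent_le hN100))
  obtain ⟨m, hmodd, -, hnot⟩ := hN₀ n hnN₀ r hr'
  exact hnot (hfac.patternMatrix_knapsackGap_of_tspSlack hn0 hle hmodd)

end Literature.Combinatorics.Optimization

end
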